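import Literature.MathematicalPhysics.QuantumFieldTheory.Balaban1983to89.B10Assembly
import Literature.MathematicalPhysics.QuantumFieldTheory.Balaban1985CMP102.Binders

/-!
# Bałaban CMP 102 (1985) 255–275, d = 3 lattice UV stability AS PRINTED — prover seat p6 (lane `pub-balaban3d`):
# the representation (29) + (30) + (32) ⇒ (33)/(60) — the step leaf `Repr33_60` (and the chart calculus its (61)-twin
# `Decomp35_61` re-uses in `…Proofs.LogZLocalized`)
# of `B10SectAGathering.StepLeaves`, CARRIER-PARAMETRIC (any `T : B10.TowerRun`, any `P : StepPieces T k`);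
# sibling `…Balaban3D.VacuumAndBooking` does `VacuumWhole`/`RmSucc`

Source: T. Bałaban, *Ultraviolet stability of three-dimensional lattice pure gauge field theories*, Commun. Math.
Phys. **102** (1985) 255–275, doi:10.1007/bf01229380 [Balaban1985UV3] (= [B10]; held as
`paper:balaban1985-cmp102-uv-stability-3d`; journal page = PDF page + 254).  Every quotation below was read on the
page RENDERS `run/shared/lean/pub/pub-balaban/b2b-balaban-ref1/pages/1985-cmp102-uv-stability-3d/…-p009/p010/p011/
p017/p018-x2.png` (pp. 263, 264, 265, 271, 272) as images; `p. N Lnn` = journal page N, line nn of the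
materialised text-layer file `p00(N−254).txt` of `lit read` (its L1 is the running head; the lane PLAN §1 convention).

HONEST FRAMING (lane PLAN.md §0, binding).  [B10] proves UV stability of the d = 3 Wilson lattice gauge theory on a
finite torus — NOT a continuum limit, NOT infinite volume, NOT a mass gap, NOT d = 4, NOT the Millennium problem.
This file asserts NO sentence of the paper: every printed input is a HYPOTHESIS (a field of the structure
`ChartExpansion` — among them the lane's GAP binders `Balaban1985CMP102.Binders.ChartAnalyticityAsCited` (G3D-01) and
`….FarTermsDecayAsCited` (G3D-06) BY NAME — or an explicit binder of a theorem), and every `theorem` is [folklore] calculus / finite-sum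
bookkeeping or the composition of kernel-checked LQB theorems its docstring names.  LQB = the 4D cell's
`Literature.MathematicalPhysics.QuantumFieldTheory.Balaban1983to89.*` (imported BY NAME, nothing re-typed):
`B10.TowerRun`, `B10SectAGathering.StepPieces/Repr33_60/Decomp35_61/VacuumWhole/RmSucc/taylor7_remainder_le`,
`B10Assembly.Repr33_60Raw/repr33_60_of_raw/rawConst7`,
`Literature.Analysis.Complex.taylorPolynomial`.

WHAT THE PAPER PRINTS HERE (pp. 263–264, k = 0; p. 271, k ≥ 1).  (29) p. 263 L34–35: «By the gauge invariance (26),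
we have 𝒫′₁(g₀, X, U₁) = 𝒫′₁(g₀, X, exp i𝓗(B)), (29) and we expand the function with respect to 𝓗(B). Because of
the bound (28) it is enough to expand up to the sixth order, hence (30) 𝒫′₁(g₀, X, exp i𝓗(B)) = 𝒫′₁(g₀, X, 1) +
⟨(δ/δ𝓗 𝒫′₁)(g₀, X, 1), 𝓗(B)⟩ + Σ_{n=2}^{6} (1/n!)⟨(δⁿ/δ𝓗ⁿ 𝒫′₁)(g₀, X, 1), ⊗ⁿ𝓗(B)⟩ + O(g₀⁷)e^{−κ𝓛(X)}.»;
(32) p. 264 L8: «(δ/δ𝓗(b) 𝒫′₁)(g₀, X, 1) = 0. (32) It is the only place we use the semi-simplicity»; p. 264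
L12–25: «Let us consider the terms in the sum over n in (30). The function 𝓗(B) = HB + A₁ is determined by the
solution A₁ of Eq. (158) [7], and this solution is an analytic function of HB, or B. We expand it up to the sixth
order at most, and we estimate remainders by the last term in (30). Finally we estimate terms with B localized in
□₁ᶜ by the last term in (30) with the constant proportional to an arbitrary power of g₀. … Thus we obtain
expressions which are polynomials in B of at least the second order, and at most the sixth order, localized in □₁.
… We use the remaining exp(−κ₁𝓛(X)) to control a sum over all X contributing to a given monomial in variables B.
Thus we obtain the following very simple representation (33) Σ_X 𝒫′₁(g₀, X, U₁) = Σ_X 𝒫′₁(g₀, X, 1) + Σ_Y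
𝒫₁(g₀, Y, U₁) + O(ε^{3+κ₀})|T₁|»; p. 271 L4–11 (k ≥ 1): «We expand the function 𝒫′_{k+1}(g_k, X, exp iη𝓗(B))
with respect to 𝓗(B) at first, up to the sixth order, so we have the formula (30) (for η-scale). The same
conclusion (32) holds for the first order functional derivative of 𝒫′_{k+1}(g_k, X, exp iη𝓗) at 𝓗 = 0. Next we
expand 𝓗(B) with respect to B, again up to the sixth order. Finally we estimate all terms with B localized in □₁ᶜ
using the exponential decay of propagators. Summing up terms with the same monomial in B yields the following analog
of (33), (60) Σ_X 𝒫′_{k+1}(g_k, X, U_{k+1}) = Σ_X 𝒫′_{k+1}(g_k, X, 1) + Σ_{Y_{k+1}} 𝒫_{k+1}(g_k, Y_{k+1}, U_{k+1}) +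
O((L^kε)^{3+κ₀})|T₁^{(k)}|»; (61) p. 271 L14–17 and L20–21 «To complete the proof of the inductive assumption (41) we
have to expand the term (61) analogously to (60).», L34–36 «Its logarithm is equal to a sum of an absolute constant,
cancelled by the same constant from the second term in (61), and the expression (63)», p. 272 L24–27 «Now let us
notice that gathering together the first terms in the expansions (30) we obtain the expansion of (63) for the
external field U_{k+1} = 1. This is cancelled by the second term in (61), and we obtain the desired expansion.».

THE READING KERNEL-CHECKED HERE.  With `Ψ_X := B ↦ 𝒫′_{k+1}(g_k, X, exp iη𝓗(B))` (the COMPOSITE of (29) with the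
analytic chart 𝓗(B) of [7] Sect. F, p. 264 L13–14 «an analytic function of HB, or B»), the printed two-stage
sixth-order expansion (in 𝓗, then in B) is, up to degree 6 in B, the Taylor polynomial of order < 7 of `Ψ_X` at
`B = 0` (𝓗(0) = 0), so both printed remainders are ONE seventh-order Cauchy remainder of `Ψ_X` in `B`
(`B10SectAGathering.taylor7_remainder_le`: `2·M_X·(2s/ρ)⁷` for `‖B‖ ≤ s ≤ ρ/4`); (32) kills the first-order term
(`fderiv ℂ Ψ_X 0 = 0`); the orders 2–6 (`jet26`) summed over X ARE Σ_Y 𝒫(Y, U) up to the monomials «with B localized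
in □₁ᶜ» that the print moves into the remainder (field `far`).  Result: the RAW leaf `B10Assembly.Repr33_60Raw`
(`|PprU − Ppr1 − PY| ≤ Craw·g_k⁷(r(g_k)p(g_k))⁷·vol`, `Craw = CM·(2(2cB/ρ)⁷ + Cfar)`), which LQB's `repr33_60_of_raw`
turns into the leaf `Repr33_60` with the k-, ε-free constant `rawConst7 Craw b₀ r₀ p₀ g κ₀`; the (61)-twin
(`Decomp35_61`) uses the same chart calculus on the localized pieces of (63) — sibling `…Proofs.LogZLocalized`, from the
lane's GAP binder G3D-07 («(63) as cited») with the small/large split of the domains proved there.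
HYPOTHESES AND THEIR STATUS (lane rule: binder = LQB leaf conjunct or countersigned spine decl; anything else is a
NAMED GAP reported to the lead).  Printed displays of [B10] (spine rows of typer-1 `SectA` / typer-2 `SectC`): (25),
(27), (28), (29), (30), (32), (33)/(34), (59), (60) — the fields of `ChartExpansion` and the identification
hypotheses `hU`/`h1`/`hY` (at the lane's `seriesPieces`: `rfl`, `rfl`, and the one identification of the data `PY`).  Series binders: b11 Sect. F / (158) (the chart, LQB
`B11.SectFPrinted`), b9 (3.156)/(3.183)/(3.185) (the localized pieces of (63), LQB `B9SectECov`, `B9Eq3185`), (25)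
at g = g_k (`B10.Bound25Printed`, p5's cumulant leaves).  NOT IN PRINT (reported to the lane lead, GAP row G3D-01):
the analyticity RADIUS `ρ` of `Ψ_X` in `B` with the sup bound on the complex ball (p. 263 L6–7 «These properties
follow from the results of previous papers», cell pub-balaban GAPS G-B10-04) and the window 0 < κ₀ < ½ of the LQB
power counting (print: «κ₀ > 0»).  WHAT IS NOT HERE: any construction of 𝒫′, 𝒫, log Z^{(k)}, 𝓗(B) or of `run3`
(seats p1/p5; this file is instantiated at `run3`'s `StepPieces` by application); the leaves `VacuumWhole`, `RmSucc`
(sibling `…Balaban3D.VacuumAndBooking`), `Norm35` (LQB `B10Eq35Norm.norm35_of_model`); (26), (31) (LQB `B10Eq26*`,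
`B10Eq31GlobalConj`) and the Lie-algebra step of (32) (LQB `B10.invariant_vector_eq_zero`), which enter through `eq32`.
PLACEMENT: lane cell topic `Summits/QuantumFields/Balaban3D/Proofs/` (PLAN §3.0 R-PATH).  Record: HOME
`run/shared/lean/pub/pub-balaban3d/` (STATUS lines [p6]).
-/

noncomputable section

open scoped Topology Nat
open Metric Set Finset
open Literature.MathematicalPhysics.QuantumFieldTheory.Balaban1983to89
open Literature.MathematicalPhysics.QuantumFieldTheory.Balaban1983to89.B10
open Literature.MathematicalPhysics.QuantumFieldTheory.Balaban1983to89.B10SectAGathering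
open Literature.MathematicalPhysics.QuantumFieldTheory.Balaban1983to89.B10Assembly
open Literature.Analysis.Complex (taylorPolynomial)
open Literature.MathematicalPhysics.QuantumFieldTheory.Balaban1985CMP102.Binders
  (ChartAnalyticityAsCited FarTermsDecayAsCited)

namespace Summit.QuantumFields.Balaban3D.Proofs.Representation33

/-! ## §1 The calculus of (30) with (32): orders 0, 1, 2–6 and the seventh-order remainder -/

section Jet

variable {E : Type*} [NormedAddCommGroup E] [NormedSpace ℂ E]
  {F : Type*} [NormedAddCommGroup F] [NormedSpace ℂ F]

/-- The displayed middle sum of **(30)** p. 263: `Σ_{n=2}^{6} (1/n!) ⟨(δⁿ/δ𝓗ⁿ 𝒫′)(g, X, 1), ⊗ⁿ 𝓗⟩` — the Taylor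
terms of orders 2, …, 6 at `0` of a map `Ψ`, evaluated on the diagonal `(B, …, B)` («polynomials in B of at least the
second order, and at most the sixth order», p. 264 L18–20). [cite: Balaban1985UV3, (30) p.263] -/
def jet26 (Ψ : E → F) (B : E) : F :=
  ∑ n ∈ Finset.Ico 2 7, ((n ! : ℂ)⁻¹ • iteratedFDeriv ℂ n Ψ 0 fun _ => B)

/-- The right-hand side of (30) without its remainder IS the Taylor polynomial of order < 7 at 0
(`Literature.Analysis.Complex.taylorPolynomial`): `Ψ 0` (= 𝒫′(g, X, 1)), `DΨ(0)B`, then `jet26`. [folklore] -/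
theorem taylorPolynomial_seven_eq (Ψ : E → F) (B : E) :
    taylorPolynomial Ψ 0 7 B = Ψ 0 + fderiv ℂ Ψ 0 B + jet26 Ψ B := by
  unfold taylorPolynomial jet26
  simp only [sub_zero]
  rw [Finset.range_eq_Ico, ← Finset.sum_Ico_consecutive _ (show 0 ≤ 2 by norm_num) (show 2 ≤ 7 by norm_num)]
  congr 1
  rw [Finset.sum_Ico_succ_top (by norm_num : 0 ≤ 1), Finset.sum_Ico_succ_top (by norm_num : 0 ≤ 0),
    Finset.Ico_self, Finset.sum_empty]
  simp only [Nat.factorial_zero, Nat.factorial_one, Nat.cast_one, inv_one, one_smul,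
    iteratedFDeriv_zero_apply, iteratedFDeriv_one_apply, zero_add]

/-- At `B = 0` the order-2…6 polynomial vanishes (`n`-linear terms, `n ≥ 2`, at the zero tuple). [folklore] -/
theorem jet26_apply_zero (Ψ : E → F) : jet26 Ψ 0 = 0 := by
  unfold jet26
  refine Finset.sum_eq_zero fun n hn => ?_
  have hn2 : 2 ≤ n := (Finset.mem_Ico.1 hn).1
  haveI : Nonempty (Fin n) := ⟨⟨0, by omega⟩⟩
  rw [show (fun _ : Fin n => (0 : E)) = 0 from rfl, ContinuousMultilinearMap.map_zero, smul_zero]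

variable [FiniteDimensional ℂ E] [CompleteSpace F]

/-- **(30) with (32) inserted, one localization**: if `Ψ` is holomorphic on `ball 0 ρ`, bounded by `M` on
`closedBall 0 (ρ/2)`, has VANISHING FIRST DERIVATIVE AT 0 ((32) p. 264 L8: «(δ/δ𝓗(b) 𝒫′₁)(g₀, X, 1) = 0»), and
`‖B‖ ≤ s ≤ ρ/4`, `0 ≤ s`, then `‖Ψ B − Ψ 0 − jet26 Ψ B‖ ≤ 2M(2s/ρ)⁷` — what is left of (30) after the
zeroth-order term and the order-2…6 polynomial is «the last term in (30)», in the quantitative form of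
`B10SectAGathering.taylor7_remainder_le` (the degenerate case `s = 0` forces `B = 0`, where both sides vanish).
[cite: Balaban1985UV3, (30)+(32) pp.263–264] -/
theorem norm_sub_sub_jet26_le {Ψ : E → F} {ρ M s : ℝ} (hρ : 0 < ρ)
    (hΨ : DifferentiableOn ℂ Ψ (ball 0 ρ)) (hM : ∀ z ∈ closedBall (0 : E) (ρ / 2), ‖Ψ z‖ ≤ M)
    (h32 : fderiv ℂ Ψ 0 = 0) (hs : 0 ≤ s) (hsρ : s ≤ ρ / 4) {B : E} (hB : ‖B‖ ≤ s) :
    ‖Ψ B - Ψ 0 - jet26 Ψ B‖ ≤ 2 * M * (2 * s / ρ) ^ 7 := by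
  rcases hs.eq_or_lt with hs0 | hs'
  · subst hs0
    have hB0 : B = 0 := norm_le_zero_iff.1 hB
    subst hB0
    have hM0 : 0 ≤ M := (norm_nonneg _).trans (hM 0 (mem_closedBall_self (by positivity)))
    rw [jet26_apply_zero, sub_self, zero_sub, norm_neg, norm_zero]
    positivity
  have h := taylor7_remainder_le hρ hΨ hM hs' hsρ hB
  have h0 : fderiv ℂ Ψ 0 B = 0 := by rw [h32]; rfl
  rw [taylorPolynomial_seven_eq, h0, add_zero, ← sub_sub] at h
  exact h

/-- **(30)+(32) summed over the localizations** (p. 264 L23–25 «a sum over all X contributing to a given monomial»;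
p. 271 L9 «Summing up terms with the same monomial in B»): for a finite family `Ψ X`, `X ∈ loc`, each as in
`norm_sub_sub_jet26_le` with bound `M X` at its own chart configuration `B X` (the configuration (27) is relative
to the cube of X), `‖Σ_X (Ψ X (B X) − Ψ X 0 − jet26 (Ψ X) (B X))‖ ≤ 2(Σ_X M X)(2s/ρ)⁷`.
[cite: Balaban1985UV3, (30)+(33) pp.263–264] -/
theorem norm_sum_sub_sub_jet26_le {ι : Type*} (loc : Finset ι) (Ψ : ι → E → F) (M : ι → ℝ) {ρ s : ℝ}
    (hρ : 0 < ρ) (hΨ : ∀ X ∈ loc, DifferentiableOn ℂ (Ψ X) (ball 0 ρ))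
    (hM : ∀ X ∈ loc, ∀ z ∈ closedBall (0 : E) (ρ / 2), ‖Ψ X z‖ ≤ M X)
    (h32 : ∀ X ∈ loc, fderiv ℂ (Ψ X) 0 = 0) (hs : 0 ≤ s) (hsρ : s ≤ ρ / 4) {B : ι → E}
    (hB : ∀ X ∈ loc, ‖B X‖ ≤ s) :
    ‖∑ X ∈ loc, (Ψ X (B X) - Ψ X 0 - jet26 (Ψ X) (B X))‖ ≤ 2 * (∑ X ∈ loc, M X) * (2 * s / ρ) ^ 7 := by
  calc ‖∑ X ∈ loc, (Ψ X (B X) - Ψ X 0 - jet26 (Ψ X) (B X))‖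
      ≤ ∑ X ∈ loc, ‖Ψ X (B X) - Ψ X 0 - jet26 (Ψ X) (B X)‖ := norm_sum_le _ _
    _ ≤ ∑ X ∈ loc, 2 * M X * (2 * s / ρ) ^ 7 :=
        Finset.sum_le_sum fun X hX => norm_sub_sub_jet26_le hρ (hΨ X hX) (hM X hX) (h32 X hX) hs hsρ (hB X hX)
    _ = 2 * (∑ X ∈ loc, M X) * (2 * s / ρ) ^ 7 := by
        rw [Finset.mul_sum, Finset.sum_mul]

end Jet

/-! ## §2 The chart-expansion data of one step and the raw representation bound (33)/(60), (61) -/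

section Chart

variable {T : TowerRun} {k : ℕ}

/-- Elementary: the right-hand side `cB·r(g)·g·p(g)` of (28) is `≥ 0` for `0 < g ≤ 1`, `0 ≤ b₀`, `0 ≤ cB`. [folklore] -/
theorem bound28_rhs_nonneg {cB r₀ b₀ p₀ g : ℝ} (hcB : 0 ≤ cB) (hb₀ : 0 ≤ b₀) (hg : 0 < g) (hg1 : g ≤ 1) :
    0 ≤ cB * (rFun r₀ g * g * pFun b₀ p₀ g) := by
  have hu := log_inv_nonneg_of_le_one hg hg1; have hp := pFun_nonneg b₀ p₀ g hb₀ hg hg1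
  have hr : 0 ≤ rFun r₀ g := by unfold rFun; exact Real.rpow_nonneg (by linarith) _
  positivity

/-- The k-INDEPENDENT CONSTANTS of the chart expansion («the constant O(1) is independent of ε, k», Thm 1 p. 257;
lane ruling R-CONST: one constant profile for all steps and all lattice approximations): `ρ` = the analyticity radius
in `B` (NOT IN PRINT, cell pub-balaban GAPS G-B10-04 / lane GAP G3D-01), `cB` = the absolute constant of **(28)**
p. 263 L28–33 («8L²3R₁M₁» at k = 0; «This bound, with a different absolute constant, extends to the whole configuration
B»), `r₀` = the exponent of r(g) = (1 + log g⁻¹)^{r₀} ((7) p. 257; free in print, GAPS G-B10-02), `CM` = the O(1) of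
**(25)** p. 262 summed over the localizations through one block («O(g₀)e^{−κ𝓛(X)}», «κ can be arbitrarily large if M₁
is sufficiently large»; the factor g_k ≤ 1 given away), `Cfar` = the constant of p. 264 L15–18 («terms with B
localized in □₁ᶜ … by the last term in (30) with the constant proportional to an arbitrary power of g₀»), RELATIVE
to the size `M_X·g_k⁷(r(g_k)p(g_k))⁷` of the last term of (30) for the domain X. [cite: Balaban1985UV3, (25)–(28) pp.262–263] -/
structure ChartConsts where
  /-- analyticity radius in `B` (NOT IN PRINT) -/
  ρ : ℝ
  /-- (28): the absolute constant in `‖B‖ ≤ cB·r(g_k)g_kp(g_k)` -/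
  cB : ℝ
  /-- (7): exponent of `r(g)` -/
  r₀ : ℝ
  /-- (25) summed per block -/
  CM : ℝ
  /-- p. 264 L15–18: the dropped far monomials -/
  Cfar : ℝ
  ρ_pos : 0 < ρ
  cB_nonneg : 0 ≤ cB
  r₀_nonneg : 0 ≤ r₀
  CM_nonneg : 0 ≤ CM
  Cfar_nonneg : 0 ≤ Cfar

namespace ChartConsts
/-- The raw constant the chart expansion produces in front of `g_k⁷(r(g_k)p(g_k))⁷·vol`: `CM·(2(2cB/ρ)⁷ + Cfar)`
— a function of the constants only, hence the same for every k. [cite: Balaban1985UV3, (30) p.263 + (33) p.264] -/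
def Craw (κc : ChartConsts) : ℝ := κc.CM * (2 * (2 * κc.cB / κc.ρ) ^ 7 + κc.Cfar)

/-- `0 ≤ Craw`. [folklore] -/
theorem Craw_nonneg (κc : ChartConsts) : 0 ≤ κc.Craw := by
  have := κc.CM_nonneg; have := κc.Cfar_nonneg; have := κc.ρ_pos; have := κc.cB_nonneg; unfold Craw; positivity

end ChartConsts
/-- HYPOTHESIS STRUCTURE — the printed inputs of the passage (29) → (33) (k = 0, pp. 263–264) / p. 271 L2–11 → (60)
(k ≥ 1) at ONE step k, over a finite index type `ι` of localizations, a finite-dimensional complex normed space `E` of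
(complexified) configurations `B` on the bonds of `□₁ ∩ T^{(k+1)}` ((27)), and a constant profile `κc : ChartConsts`.
Fields: `loc h` = the retained localizations `X ⊂ Ω_{k+1}` in cubes of size `R(g_k)M₁` ((24) p. 262 / (59) p. 270);
`Ψ X` = the chart pull-back `B ↦ 𝒫′_{k+1}(g_k, X, exp iη𝓗(B))` of **(29)** p. 263 «𝒫′₁(g₀, X, U₁) = 𝒫′₁(g₀, X, exp
i𝓗(B))» (U₁ «represented as exp i𝓗(B) in the neighbourhood of □₁» by Sect. F [7], 𝓗(B) = HB + A₁ with A₁ «an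
analytic function of HB, or B», p. 264 L12–14 — binder b11 Sect. F/(158)); `Bcfg X h U` = the configuration B of **(27)** (relative to the cube □ ∋ X of centre y: «Let y denote the center of
□. The configuration B restricted to □₁ …», p. 263 L22–24);
`chart` = «The third property is the analyticity with respect to U₁. These properties follow from the
results of previous papers» (p. 263 L6–7) made quantitative — the lane's GAP binder G3D-01 BY NAME,
`Balaban1985CMP102.Binders.ChartAnalyticityAsCited (Ψ X) ρ (M X)` (`Ψ X` holomorphic on `ball 0 ρ`, bounded by `M X`
on `closedBall 0 (ρ/2)`; the radius is NOT IN PRINT); `sumM_le` = **(25)**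
summed over the localizations through the blocks of a region of `vol h ≤ |T₁^{(k)}|` blocks (p. 264 L23–25 «We use the
remaining exp(−κ₁𝓛(X)) to control a sum over all X»); `bound28`/`small28` = **(28)** p. 263 «|B(c)| <
4L²|c₋ − y|g₀p(g₀) < 8L²3R₁M₁r(g₀)g₀p(g₀), and for g₀ sufficiently small the number on the right-hand side above is
small»; `eq32` = **(32)** p. 264 L8 «(δ/δ𝓗(b) 𝒫′₁)(g₀, X, 1) = 0» (k ≥ 1: p. 271 L5–7 «The same conclusion (32) holds
for the first order functional derivative of 𝒫′_{k+1}(g_k, X, exp iη𝓗) at 𝓗 = 0»; the route (26) ⇒ (31) ⇒ (32) from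
global gauge invariance + semisimplicity is LQB `B13DerivZeroGauge.fderiv_eq_zero_of_linearInvariant_ball` /
`derivZeroAlongV_of_semisimple` with `B10.invariant_vector_eq_zero`, by which an instantiation discharges this
field); `far`/`far_le` = p. 264 L15–18 (k ≥ 1: p. 271 L8–9) — per domain X, the monomials of orders 2–6 NOT retained in Σ_Y,
bounded «by the last term in (30)» of that domain: the lane's GAP binder G3D-06 BY NAME,
`Balaban1985CMP102.Binders.FarTermsDecayAsCited far M Cfar (g_k⁷(r(g_k)p(g_k))⁷)`.  Nothing is constructed; every field is a hypothesis the carrier seat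
discharges or the lane carries as a binder. [cite: Balaban1985UV3, (25)–(32) pp.262–264 + p.271] -/
structure ChartExpansion (T : TowerRun) (k : ℕ) (ι E : Type) [NormedAddCommGroup E] [NormedSpace ℂ E]
    [FiniteDimensional ℂ E] (κc : ChartConsts) where
  /-- retained localizations of history `h` ((24)/(59)) -/
  loc : T.Hist (k + 1) → Finset ι
  /-- (29): `Ψ X B = 𝒫′_{k+1}(g_k, X, exp iη𝓗(B))` -/
  Ψ : ι → E → ℂ
  /-- (27): the configuration `B = B(h, U)` of the chart around the cube of `X` -/
  Bcfg : ι → T.Hist (k + 1) → T.Cfg (k + 1) → E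
  /-- sup bound of `Ψ X` on the half ball ((25) on the complex neighbourhood) -/
  M : ι → ℝ
  /-- p. 263 L6–7 analyticity, radius `κc.ρ`, bound `M X`: the lane's GAP binder G3D-01 BY NAME
  (`Balaban1985CMP102.Binders.ChartAnalyticityAsCited`) -/
  chart : ∀ X, ChartAnalyticityAsCited (Ψ X) κc.ρ (M X)
  /-- number of blocks carrying the retained localizations, `≤ |T₁^{(k)}|` -/
  vol : T.Hist (k + 1) → ℝ
  vol_nonneg : ∀ h, 0 ≤ vol h
  vol_le : ∀ h, vol h ≤ T.sites k
  /-- (25) summed: `Σ_{X ∈ loc h} M X ≤ CM · vol h` -/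
  sumM_le : ∀ h, ∑ X ∈ loc h, M X ≤ κc.CM * vol h
  /-- (28): `‖B‖ ≤ cB · r(g_k) g_k p(g_k)` -/
  bound28 : ∀ X h U, ‖Bcfg X h U‖ ≤ κc.cB * (rFun κc.r₀ (T.g k) * T.g k * pFun T.b₀ T.p₀ (T.g k))
  /-- «for g₀ sufficiently small the number on the right-hand side above is small» -/
  small28 : κc.cB * (rFun κc.r₀ (T.g k) * T.g k * pFun T.b₀ T.p₀ (T.g k)) ≤ κc.ρ / 4
  /-- (32): no first-order term -/
  eq32 : ∀ X, fderiv ℂ (Ψ X) 0 = 0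
  /-- the order-2…6 monomials of domain `X` with B localized in □₁ᶜ, dropped from Σ_Y (p. 264 L15–18) -/
  far : ι → T.Hist (k + 1) → T.Cfg (k + 1) → ℝ
  /-- … bounded «by the last term in (30)» of that domain: GAP binder G3D-06 BY NAME (`Binders.FarTermsDecayAsCited`) -/
  far_le : FarTermsDecayAsCited far M κc.Cfar (T.g k ^ 7 * (rFun κc.r₀ (T.g k) * pFun T.b₀ T.p₀ (T.g k)) ^ 7)

namespace ChartExpansion

variable {ι E : Type} [NormedAddCommGroup E] [NormedSpace ℂ E] [FiniteDimensional ℂ E] {κc : ChartConsts}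
  (D : ChartExpansion T k ι E κc)

/-- `Σ_X 𝒫′_{k+1}(g_k, X, U_{k+1})` through the chart **(29)**: `Σ_{X ∈ loc h} Re Ψ X (B_X(h, U))` (the pieces are
real on real configurations; `Re` is the typed bridge from the complex-analytic `Ψ`). [cite: Balaban1985UV3, (29) p.263] -/
def total (h : T.Hist (k + 1)) (U : T.Cfg (k + 1)) : ℝ := ∑ X ∈ D.loc h, (D.Ψ X (D.Bcfg X h U)).re

/-- `Σ_X 𝒫′_{k+1}(g_k, X, 1)`: `Σ_{X ∈ loc h} Re Ψ X 0` (B = 0 ↔ U_{k+1} = 1). [cite: Balaban1985UV3, (30) p.263] -/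
def total0 (h : T.Hist (k + 1)) : ℝ := ∑ X ∈ D.loc h, (D.Ψ X 0).re

/-- `Σ_Y 𝒫_{k+1}(g_k, Y, U_{k+1})` of **(33)/(60)**: the RETAINED order-2…6 monomials, `Σ_X (Re jet26 (Ψ X) B_X − far_X)`
(p. 264 L18–25; (34) «n ≥ 2»). [cite: Balaban1985UV3, (33)–(34) p.264 + (60) p.271] -/
def poly (h : T.Hist (k + 1)) (U : T.Cfg (k + 1)) : ℝ :=
  ∑ X ∈ D.loc h, ((jet26 (D.Ψ X) (D.Bcfg X h U)).re - D.far X h U)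

/-- **(33)/(60) in raw form from the chart data** (p. 264 L12–25 / p. 271 L4–11) as ONE inequality:
`|total − total0 − poly| ≤ Craw·g_k⁷(r(g_k)p(g_k))⁷·vol h` (orders 0 cancel, order 1 vanishes by (32), orders 2–6 are
`poly + far`, the rest is the seventh-order Cauchy remainder summed with (25)). [cite: Balaban1985UV3, (33) p.264 + (60) p.271] -/
theorem abs_total_sub_le (hg : 0 < T.g k) (hg1 : T.g k ≤ 1) (hb₀ : 0 ≤ T.b₀) (h : T.Hist (k + 1))
    (U : T.Cfg (k + 1)) :
    |D.total h U - D.total0 h - D.poly h U|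
      ≤ κc.Craw * (T.g k ^ 7 * (rFun κc.r₀ (T.g k) * pFun T.b₀ T.p₀ (T.g k)) ^ 7) * D.vol h := by
  have hs0 : 0 ≤ κc.cB * (rFun κc.r₀ (T.g k) * T.g k * pFun T.b₀ T.p₀ (T.g k)) :=
    bound28_rhs_nonneg κc.cB_nonneg hb₀ hg hg1
  have hkey := norm_sum_sub_sub_jet26_le (D.loc h) D.Ψ D.M κc.ρ_pos (fun X _ => (D.chart X).2.1)
    (fun X _ => (D.chart X).2.2) (fun X _ => D.eq32 X) hs0 D.small28 (fun X _ => D.bound28 X h U)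
  set z := ∑ X ∈ D.loc h, (D.Ψ X (D.Bcfg X h U) - D.Ψ X 0 - jet26 (D.Ψ X) (D.Bcfg X h U)) with hz
  set c : ℝ := T.g k ^ 7 * (rFun κc.r₀ (T.g k) * pFun T.b₀ T.p₀ (T.g k)) ^ 7 with hc
  have hre : D.total h U - D.total0 h - D.poly h U = z.re + ∑ X ∈ D.loc h, D.far X h U := by
    simp only [total, total0, poly, hz, Complex.re_sum, Complex.sub_re, Finset.sum_sub_distrib]; ring
  have hc0 : 0 ≤ c := by
    have hu := log_inv_nonneg_of_le_one hg hg1; have hp := pFun_nonneg T.b₀ T.p₀ (T.g k) hb₀ hg hg1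
    have hr : 0 ≤ rFun κc.r₀ (T.g k) := by unfold rFun; exact Real.rpow_nonneg (by linarith) _
    positivity
  have hq : (2 * (κc.cB * (rFun κc.r₀ (T.g k) * T.g k * pFun T.b₀ T.p₀ (T.g k))) / κc.ρ) ^ 7
      = (2 * κc.cB / κc.ρ) ^ 7 * c := by rw [hc]; ring
  rw [hq] at hkey
  have hA : 0 ≤ (2 * κc.cB / κc.ρ) ^ 7 * c := by have := κc.cB_nonneg; have := κc.ρ_pos; positivity
  have h2 : |∑ X ∈ D.loc h, D.far X h U| ≤ κc.Cfar * (∑ X ∈ D.loc h, D.M X) * c := by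
    calc |∑ X ∈ D.loc h, D.far X h U| ≤ ∑ X ∈ D.loc h, |D.far X h U| := Finset.abs_sum_le_sum_abs _ _
      _ ≤ ∑ X ∈ D.loc h, κc.Cfar * (D.M X * c) := Finset.sum_le_sum fun X _ => D.far_le X h U
      _ = κc.Cfar * (∑ X ∈ D.loc h, D.M X) * c := by
          rw [Finset.mul_sum, Finset.sum_mul]; exact Finset.sum_congr rfl fun X _ => by ring
  have h5 : 2 * (∑ X ∈ D.loc h, D.M X) * ((2 * κc.cB / κc.ρ) ^ 7 * c)
      ≤ 2 * (κc.CM * D.vol h) * ((2 * κc.cB / κc.ρ) ^ 7 * c) :=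
    mul_le_mul_of_nonneg_right (mul_le_mul_of_nonneg_left (D.sumM_le h) (by norm_num)) hA
  have h6 : κc.Cfar * (∑ X ∈ D.loc h, D.M X) * c ≤ κc.Cfar * (κc.CM * D.vol h) * c :=
    mul_le_mul_of_nonneg_right (mul_le_mul_of_nonneg_left (D.sumM_le h) κc.Cfar_nonneg) hc0
  rw [hre]
  calc |z.re + ∑ X ∈ D.loc h, D.far X h U| ≤ |z.re| + |∑ X ∈ D.loc h, D.far X h U| := abs_add_le _ _
    _ ≤ 2 * (κc.CM * D.vol h) * ((2 * κc.cB / κc.ρ) ^ 7 * c) + κc.Cfar * (κc.CM * D.vol h) * c := by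
        linarith [Complex.abs_re_le_norm z, hkey, h2, h5, h6]
    _ = κc.Craw * c * D.vol h := by unfold ChartConsts.Craw; ring

end ChartExpansion

/-- **`Repr33_60Raw` from the chart expansion**: if the step pieces `PprU`, `Ppr1`, `PY` of `B10SectAGathering` ARE
the three chart sums (`total`, `total0`, `poly`: (29) over the retained localizations (24)/(59), and (33)/(60)
«Summing up terms with the same monomial in B»), then the raw representation leaf `B10Assembly.Repr33_60Raw P Craw r₀
vol` holds with `Craw = CM·(2(2cB/ρ)⁷ + Cfar)` (`ChartConsts.Craw`, the same for every k).  Bookkeeping over `ChartExpansion.abs_total_sub_le`.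
[cite: Balaban1985UV3, (33) p.264 + (60) p.271] -/
theorem repr33_60Raw_of_chart {ι E : Type} [NormedAddCommGroup E] [NormedSpace ℂ E] [FiniteDimensional ℂ E]
    {κc : ChartConsts} (P : StepPieces T k) (D : ChartExpansion T k ι E κc) (hg : 0 < T.g k) (hg1 : T.g k ≤ 1)
    (hb₀ : 0 ≤ T.b₀) (hU : ∀ h U, P.PprU h U = D.total h U) (h1 : ∀ h, P.Ppr1 h = D.total0 h)
    (hY : ∀ h U, P.PY h U = D.poly h U) :
    Repr33_60Raw P κc.Craw κc.r₀ D.vol := by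
  intro h U
  rw [hU, h1, hY, ← sub_sub]
  exact D.abs_total_sub_le hg hg1 hb₀ h U

/-- **Leaf `Repr33_60` of `B10SectAGathering.StepLeaves` from the chart expansion** — the TYPE is literally the leaf:
composition of `repr33_60Raw_of_chart` with LQB `B10Assembly.repr33_60_of_raw` (the printed «O(ε^{3+κ₀})|T₁|» /
«O((L^kε)^{3+κ₀})|T₁^{(k)}|» of (33)/(60) with the k-, ε-free constant `rawConst7 Craw b₀ r₀ p₀ g κ₀`, valid for
`g_k = g(L^kε)^{1/2} ≤ 1`, `0 < κ₀ < ½`, `rem = (L^kε)^{3+κ₀}|T₁^{(k)}|`). [cite: Balaban1985UV3, (33) p.264 + (60) p.271] -/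
theorem repr33_60_of_chart {ι E : Type} [NormedAddCommGroup E] [NormedSpace ℂ E] [FiniteDimensional ℂ E]
    {κc : ChartConsts} (P : StepPieces T k) (D : ChartExpansion T k ι E κc) (g L ε κ₀ : ℝ) (hg : 0 < g) (hL : 0 < L) (hε : 0 < ε)
    (hκ : κ₀ < 1 / 2) (hp₀ : 0 < T.p₀) (hb₀ : 0 ≤ T.b₀)
    (hgk : T.g k = gRun g L ε k) (hgk1 : T.g k ≤ 1)
    (hrem : P.rem = (L ^ k * ε) ^ (3 + κ₀) * T.sites k)
    (hU : ∀ h U, P.PprU h U = D.total h U) (h1 : ∀ h, P.Ppr1 h = D.total0 h)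
    (hY : ∀ h U, P.PY h U = D.poly h U) :
    Repr33_60 P (rawConst7 κc.Craw T.b₀ κc.r₀ T.p₀ g κ₀) :=
  have hgpos : 0 < T.g k := by rw [hgk]; exact gRun_pos g L ε hg hL hε k
  repr33_60_of_raw P g L ε κ₀ hg hL hε hκ κc.r₀_nonneg hp₀ hb₀ κc.Craw_nonneg hgk hgk1 D.vol_nonneg
    D.vol_le hrem (repr33_60Raw_of_chart P D hgpos hgk1 hb₀ hU h1 hY)

/-! The (61)-twin — `Decomp35_61` for `log Z^{(k)}(B(Λ_{k+1}), U_{k+1}) − log Z^{(k)}(B(Λ_{k+1}), 1)` — is NOT a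
second copy of the above with an identification hypothesis `logZU = J + total`: the lane DEFINES the two logarithms as
Gaussian logarithms (seat p1, ruling R-FL), and their LOCALIZATION is an input of its own («(63) as cited», the lane's
GAP binder G3D-07 `Binders.LogZLocalizedAsCited`); the leaf is proved from it, with the small/large split of the domains
inside `B(Λ_{k+1})`, in the sibling `…Proofs.LogZLocalized` (`decomp35_61_of_localization`). -/

end Chart

end Summit.QuantumFields.Balaban3D.Proofs.Representation33

end
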